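import Summits.RiemannHypothesis.RiemannHypothesis.Theses.LiAsymptotic
import Summits.RiemannHypothesis.RiemannHypothesis.Theorems.LiAsymptoticOscPlain
import Summits.RiemannHypothesis.RiemannHypothesis.Theorems.LiCoefficientsLiWindowIdentity
import Summits.RiemannHypothesis.RiemannHypothesis.Theorems.LiAsymptoticSmoothCutsLow
import HarnessLib

/-!
# RiemannHypothesis / LiAsymptotic — crux K3 `LiOscillatoryS`: the `S`-terms, TURING regime, and the crux (RH-FREE)

RH-FREE [rh-li-prover].  Route `Theses/LiAsymptotic.lean` (rung L-P(P1⁺) «Li asymptotic law, quadratic range»,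
cell `pub/rh-li`, theory memo `theory/TARGETS.md` §11.2 STEP 7), item `LiOscillatoryS` (stmt-RiemannHypothesis-19164).
THIS FILE: the registered birth stub `stub_turing` (K3b) — for `n ≥ 3·10⁵` (`a = √n > 168π`), `T' ≥ n²`,

  `|2 (S(T') f_n(T') − S(a) f_n(a) − ∫_a^{T'} S f_n')| ≤ liErrOsc n = 0.043 √n log n + 1.41 √n + 0.75 log n + 17.3`,

by a SECOND integration by parts `∫ S f_n' = [S₁ f_n'] − ∫ S₁ f_n''`, `S₁(t) = ∫_a^t S` (tree
`Window.integral_zetaArgS_mul_eq`), Turing's `|S₁(t)| ≤ 2.30 + 0.128 log(t/2π)` (`abs_integral_zetaArgS_le_turing_holds`,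
Trudgian 2011), `|f_n''| ≤ n²/t⁴ + 2n/t³` (`Window.abs_liWindowWeightDeriv2_le`), `log 2π ≥ 1.837`; and then the CRUX
`liOscillatoryS_bound` (verbatim the route statement) by the window identity `Σ_{a<γ≤b} m f_n = (1/π)∫ f_n ϑ' + [S f_n]
− ∫ S f_n'` (`Window.windowIdentity`) composed with K3a (`liOscillatoryPlain_bound`, `Theorems/LiAsymptoticOscPlain.lean`)
and K3b — the theory seat's `LiOscillatoryS_of_stubs`.  The closer `liOscillatoryS_proof` has the route decl as its
type.  Every input is a tree theorem about the zeros of `ζ` with no hypothesis on their position; nothing here bears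
on the truth of RH.
-/

noncomputable section

-- D-0017: `Summit.<S>.<S>.…` is the designed namespace of a single-problem summit.
set_option linter.dupNamespace false

open MeasureTheory intervalIntegral Set
open scoped Real Interval

namespace Summit.RiemannHypothesis.RiemannHypothesis.Theorems.LiTheory

open Literature.NumberTheory.LFunctions Literature.NumberTheory.LFunctions.SchoenfeldBound Window SmoothReplace

namespace Oscillatory

/-- `log 2π ≥ 1.837` (`e^{0.837} ≤ 2.3095` by the exponential series to order 8, `e ≤ 2.71828183`, `π ≥ 3.141592`). -/
theorem log_two_pi_ge : (1.837 : ℝ) ≤ Real.log (2 * π) := by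
  rw [Real.le_log_iff_exp_le (by positivity)]
  have hx1 : |(0.837 : ℝ)| ≤ 1 := by rw [abs_of_pos (by norm_num)]; norm_num
  have h := (abs_le.1 (Real.exp_bound hx1 (n := 8) (by norm_num))).2
  simp only [Finset.sum_range_succ, Finset.sum_range_zero, Nat.factorial] at h
  norm_num at h
  have he := Real.exp_one_lt_d9
  have hπ := Real.pi_gt_d6
  have hsplit : Real.exp 1.837 = Real.exp 1 * Real.exp 0.837 := by rw [← Real.exp_add]; norm_num
  rw [hsplit]
  nlinarith [Real.exp_pos (0.837 : ℝ), Real.exp_pos (1 : ℝ)]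

/-- The Turing majorant's antiderivative: with `α = 2.30 − 0.128 log 2π`, `β = 0.128`,
`Φ(t) = −n²((α + β log t)/(3t³) + β/(9t³)) − 2n((α + β log t)/(2t²) + β/(4t²))`. -/
def turingPhi (n : ℕ) (t : ℝ) : ℝ :=
  -(n : ℝ) ^ 2 * ((2.30 - 0.128 * Real.log (2 * π) + 0.128 * Real.log t) / 3 * (t ^ 3)⁻¹ + 0.128 / 9 * (t ^ 3)⁻¹)
    - 2 * n * ((2.30 - 0.128 * Real.log (2 * π) + 0.128 * Real.log t) / 2 * (t ^ 2)⁻¹ + 0.128 / 4 * (t ^ 2)⁻¹)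

/-- `Φ' = (2.30 + 0.128 log(t/2π))(n²/t⁴ + 2n/t³)` for `t > 0`. -/
theorem hasDerivAt_turingPhi (n : ℕ) {t : ℝ} (ht : 0 < t) :
    HasDerivAt (turingPhi n) ((2.30 + 0.128 * Real.log (t / (2 * π))) * ((n : ℝ) ^ 2 / t ^ 4 + 2 * n / t ^ 3)) t := by
  have ht0 : t ≠ 0 := ht.ne'
  have hl := Real.hasDerivAt_log ht0
  have h3 := hasDerivAt_inv_cube ht0
  have h2 := hasDerivAt_inv_sq ht0
  have hA : HasDerivAt (fun y : ℝ ↦ 2.30 - 0.128 * Real.log (2 * π) + 0.128 * Real.log y) (0.128 * t⁻¹) t := by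
    simpa using (hl.const_mul (0.128 : ℝ)).const_add (2.30 - 0.128 * Real.log (2 * π))
  have h := ((((hA.div_const 3).mul h3).add (h3.const_mul (0.128 / 9))).const_mul (-(n : ℝ) ^ 2)).sub
    ((((hA.div_const 2).mul h2).add (h2.const_mul (0.128 / 4))).const_mul (2 * (n : ℝ)))
  refine (h.congr_of_eventuallyEq (Filter.Eventually.of_forall fun y ↦ rfl)).congr_deriv ?_
  rw [Real.log_div ht0 (by positivity)]
  field_simp
  ring

/-- `Φ(t) ≤ 0` for `t ≥ 2π`. -/
theorem turingPhi_nonpos (n : ℕ) {t : ℝ} (ht : 2 * π ≤ t) : turingPhi n t ≤ 0 := by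
  have hπ3 := Real.pi_gt_three
  have ht0 : 0 < t := by linarith
  have hA : 0 ≤ 2.30 - 0.128 * Real.log (2 * π) + 0.128 * Real.log t := by
    have : Real.log (2 * π) ≤ Real.log t := Real.log_le_log (by positivity) ht
    have : Real.log (2 * π) ≤ 2 := SmoothCuts.log_two_pi_mem.2
    linarith
  unfold turingPhi
  have h1 : 0 ≤ (n : ℝ) ^ 2 * ((2.30 - 0.128 * Real.log (2 * π) + 0.128 * Real.log t) / 3 * (t ^ 3)⁻¹ + 0.128 / 9 * (t ^ 3)⁻¹) := by
    positivity
  have h2 : 0 ≤ 2 * n * ((2.30 - 0.128 * Real.log (2 * π) + 0.128 * Real.log t) / 2 * (t ^ 2)⁻¹ + 0.128 / 4 * (t ^ 2)⁻¹) := by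
    positivity
  linarith

/-- **The Turing integral**: for `168π < a ≤ b`, with `S₁(t) = ∫_a^t S`,
`|∫_a^b S₁(t) f_n''(t) dt| ≤ −Φ(a)`. -/
theorem abs_integral_S1_mul_deriv2_le (n : ℕ) {a b : ℝ} (ha : 168 * π < a) (hab : a ≤ b) :
    |∫ t in a..b, (∫ x in a..t, zetaArgS x) * liWindowWeightDeriv2 n t| ≤ -turingPhi n a := by
  have hπ3 := Real.pi_gt_three
  have ha0 : 0 < a := by linarith
  have ha2π : 2 * π ≤ a := by linarith
  have hle : ∀ᵐ t ∂volume, t ∈ Ioc a b →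
      ‖(∫ x in a..t, zetaArgS x) * liWindowWeightDeriv2 n t‖ ≤
        (2.30 + 0.128 * Real.log (t / (2 * π))) * ((n : ℝ) ^ 2 / t ^ 4 + 2 * n / t ^ 3) :=
    Filter.Eventually.of_forall fun t ht ↦ by
      have ht0 : 0 < t := by linarith [ht.1]
      rw [Real.norm_eq_abs, abs_mul]
      have hT := abs_integral_zetaArgS_le_turing_holds ha ht.1
      have hlog0 : 0 ≤ Real.log (t / (2 * π)) := Real.log_nonneg (by rw [le_div_iff₀ (by positivity)]; linarith [ht.1])
      exact mul_le_mul hT (abs_liWindowWeightDeriv2_le n ht0) (abs_nonneg _) (by positivity)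
  have hcont : ContinuousOn (fun t : ℝ ↦ (2.30 + 0.128 * Real.log (t / (2 * π))) * ((n : ℝ) ^ 2 / t ^ 4 + 2 * n / t ^ 3))
      (uIcc a b) := by
    refine continuousOn_of_forall_continuousAt fun t ht ↦ ?_
    rw [uIcc_of_le hab] at ht
    have ht0 : t ≠ 0 := by linarith [ht.1]
    have ht0' : 0 < t := by linarith [ht.1]
    have ht2π : t / (2 * π) ≠ 0 := by positivity
    have h3 : t ^ 3 ≠ 0 := pow_ne_zero 3 ht0
    have h4 : t ^ 4 ≠ 0 := pow_ne_zero 4 ht0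
    fun_prop (disch := assumption)
  have h := intervalIntegral.norm_integral_le_of_norm_le hab hle hcont.intervalIntegrable
  rw [intervalIntegral.integral_eq_sub_of_hasDerivAt (fun t ht ↦ hasDerivAt_turingPhi n (by
      rw [uIcc_of_le hab] at ht; linarith [ht.1])) hcont.intervalIntegrable, Real.norm_eq_abs] at h
  linarith [turingPhi_nonpos n (ha2π.trans hab)]

/-- The value `−Φ(√n)` in terms of `√n` and `log n` (`a² = n`). -/
theorem neg_turingPhi_sqrt {n : ℕ} {a : ℝ} (ha0 : 0 < a) (haa : a ^ 2 = n) :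
    -turingPhi n a = a * ((2.30 - 0.128 * Real.log (2 * π) + 0.128 * (Real.log n / 2)) / 3 + 0.128 / 9) +
      ((2.30 - 0.128 * Real.log (2 * π) + 0.128 * (Real.log n / 2)) + 0.128 / 2) := by
  have hloga : Real.log a = Real.log n / 2 := by
    rw [← haa, Real.log_pow]; ring
  unfold turingPhi
  rw [hloga, ← haa]
  field_simp
  ring

/-- The Turing TOP boundary term is negligible: for `n ≥ 3·10⁵`, `T' ≥ n²`,
`|S₁(T')| · |f_n'(T')| ≤ 0.0005` (`|S₁| ≤ 2.30 + 0.128 log T' ≤ 2.30 + 0.256 √T'`, `|f_n'| ≤ n/T'² ≤ 1/T'^{3/2}`). -/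
theorem turing_top_le {n : ℕ} {T' a : ℝ} (hn : 300000 ≤ n) (hT' : (n : ℝ) ^ 2 ≤ T') (ha : 168 * π < a)
    (haT : a < T') :
    |∫ x in a..T', zetaArgS x| * |liWindowWeightDeriv n T'| ≤ 0.0005 := by
  have hnR : (300000 : ℝ) ≤ n := by exact_mod_cast hn
  have hπ3 := Real.pi_gt_three
  have hT0 : 0 < T' := by nlinarith
  have hS := abs_integral_zetaArgS_le_turing_holds ha haT
  have hf := abs_liWindowWeightDeriv_le n hT0
  set r := Real.sqrt T' with hr
  have hrr : r ^ 2 = T' := Real.sq_sqrt hT0.le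
  have hrn : (n : ℝ) ≤ r := by
    rw [hr, ← Real.sqrt_sq (n.cast_nonneg : (0 : ℝ) ≤ n)]; exact Real.sqrt_le_sqrt hT'
  have hr0 : 0 < r := by linarith
  have hlogT : Real.log (T' / (2 * π)) ≤ 2 * r := by
    have h1 : Real.log (T' / (2 * π)) ≤ Real.log T' := by
      rw [Real.log_div hT0.ne' (by positivity)]; linarith [SmoothCuts.log_two_pi_mem.1]
    have h := Real.log_le_sub_one_of_pos hr0
    rw [hr, Real.log_sqrt hT0.le] at h
    rw [hr] at *; linarith
  have hA : |∫ x in a..T', zetaArgS x| ≤ 2.30 + 0.256 * r := by linarith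
  have hB : |liWindowWeightDeriv n T'| ≤ r / r ^ 4 := by
    refine hf.trans ?_
    rw [← hrr, show ((r ^ 2) ^ 2 : ℝ) = r ^ 4 by ring]
    exact div_le_div_of_nonneg_right hrn (by positivity)
  calc |∫ x in a..T', zetaArgS x| * |liWindowWeightDeriv n T'| ≤ (2.30 + 0.256 * r) * (r / r ^ 4) :=
        mul_le_mul hA hB (abs_nonneg _) (by positivity)
    _ ≤ 0.0005 := by
        rw [← mul_div_assoc, div_le_iff₀ (by positivity)]
        nlinarith [pow_pos hr0 2, pow_pos hr0 3, mul_le_mul_of_nonneg_left (hnR.trans hrn) (by positivity : (0 : ℝ) ≤ r ^ 2)]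

end Oscillatory

open Oscillatory in
/-- **Stub K3b `stub_turing` of crux `LiOscillatoryS`** (route `LiAsymptotic`, stmt-RiemannHypothesis-19164; RH-FREE):
for `n ≥ 3·10⁵`, `T' ≥ n²`, `|2(S(T') f_n(T') − S(√n) f_n(√n) − ∫_{√n}^{T'} S f_n')| ≤ liErrOsc n`.  Verbatim the
registered signature `Sig.stub_turing`. -/
theorem liOscillatoryTuring_bound :
    ∀ (n : ℕ) (T' : ℝ), 300000 ≤ n → (n : ℝ) ^ 2 ≤ T' →
      |2 * (zetaArgS T' * liWindowWeight n T' - zetaArgS (Real.sqrt n) * liWindowWeight n (Real.sqrt n) -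
          ∫ t in Real.sqrt n..T', zetaArgS t * liWindowWeightDeriv n t)| ≤ liErrOsc n := by
  intro n T' hn hT'
  have hn900 : 900 ≤ n := le_trans (by norm_num) hn
  obtain ⟨-, haa, haT, hloga, -, -⟩ := sizes hn900 hT'
  have hnR : (300000 : ℝ) ≤ n := by exact_mod_cast hn
  set a := Real.sqrt n with ha
  have ha547 : 547 ≤ a := by
    have h : Real.sqrt ((547 : ℝ) ^ 2) = 547 := Real.sqrt_sq (by norm_num)
    rw [ha, ← h]; exact Real.sqrt_le_sqrt (by linarith)
  have hπ4 := Real.pi_lt_d2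
  have ha168 : 168 * π < a := by linarith
  have ha30 : 30 ≤ a := by linarith
  have ha0 : 0 < a := by linarith
  have haT' : a < T' := by nlinarith
  -- boundary terms
  have h1 := top_term_le hn900 hT'
  have h2 := bottom_term_le n ha30
  rw [hloga] at h2
  -- second integration by parts of `∫ S f'`
  have hparts := integral_zetaArgS_mul_eq ha0.le haT
    (g := liWindowWeightDeriv n) (g' := liWindowWeightDeriv2 n)
    (fun t ht ↦ hasDerivAt_liWindowWeightDeriv n (by linarith [ht.1] : t ≠ 0))
    (continuousOn_liWindowWeightDeriv2 n ha0)
  have h3 := turing_top_le hn hT' ha168 haT'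
  have h4 := abs_integral_S1_mul_deriv2_le n ha168 haT
  rw [neg_turingPhi_sqrt ha0 haa] at h4
  have hℓ := log_two_pi_ge
  have hlogn : 0 ≤ Real.log n := Real.log_nonneg (by linarith)
  -- triangle inequality
  have hf0T : 0 ≤ liWindowWeight n T' := (liWindowWeight_mem n T').1
  have hf0a : 0 ≤ liWindowWeight n a := (liWindowWeight_mem n a).1
  have hb1 : |zetaArgS T' * liWindowWeight n T'| ≤ 0.0005 := by rw [abs_mul, abs_of_nonneg hf0T]; exact h1
  have hb2 : |zetaArgS a * liWindowWeight n a| ≤ 2 * (0.3083 * (Real.log n / 2) + 3.24) := by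
    rw [abs_mul, abs_of_nonneg hf0a]; exact h2
  have hb3 : |∫ t in a..T', zetaArgS t * liWindowWeightDeriv n t| ≤
      0.0005 + (a * ((2.30 - 0.128 * Real.log (2 * π) + 0.128 * (Real.log n / 2)) / 3 + 0.128 / 9) +
        ((2.30 - 0.128 * Real.log (2 * π) + 0.128 * (Real.log n / 2)) + 0.128 / 2)) := by
    rw [hparts]
    refine (abs_sub _ _).trans (add_le_add ?_ h4)
    rw [abs_mul]; exact h3
  have htri : ∀ x y z : ℝ, |2 * (x - y - z)| ≤ 2 * (|x| + |y| + |z|) := fun x y z ↦ by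
    rw [abs_mul, abs_two]
    refine mul_le_mul_of_nonneg_left ?_ (by norm_num)
    calc |x - y - z| ≤ |x - y| + |z| := abs_sub _ _
      _ ≤ |x| + |y| + |z| := by linarith [abs_sub x y]
  refine (htri _ _ _).trans ?_
  unfold liErrOsc
  rw [← ha]
  nlinarith [mul_nonneg ha0.le hlogn]

/-- **Crux K3 `LiOscillatoryS`** (stmt-RiemannHypothesis-19164; RH-FREE): for `T' ≥ n²`, the window sum
`2 Σ_{√n<Im ρ≤T'} m f_n(Im ρ)` equals `(2/π)∫_{√n}^{T'} f_n ϑ'` up to `liErrOscPlain n` (`n ≥ 900`) resp. `liErrOsc n`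
(`n ≥ 3·10⁵`).  Verbatim the route statement; the window identity (`Window.windowIdentity`) turns the difference into
the `S`-terms bounded by K3a/K3b (the theory seat's `LiOscillatoryS_of_stubs`). -/
theorem liOscillatoryS_bound :
    ∀ (n : ℕ) (T' : ℝ), (n : ℝ) ^ 2 ≤ T' →
      (900 ≤ n →
        |2 * (∑ ρ ∈ zerosBetween (Real.sqrt n) T', (riemannZetaZeroOrder ρ : ℝ) * liWindowWeight n ρ.im)
            - 2 / Real.pi * (∫ t in Real.sqrt n..T', liWindowWeight n t * riemannSiegelThetaDeriv t)|
          ≤ liErrOscPlain n) ∧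
      (300000 ≤ n →
        |2 * (∑ ρ ∈ zerosBetween (Real.sqrt n) T', (riemannZetaZeroOrder ρ : ℝ) * liWindowWeight n ρ.im)
            - 2 / Real.pi * (∫ t in Real.sqrt n..T', liWindowWeight n t * riemannSiegelThetaDeriv t)|
          ≤ liErrOsc n) := by
  intro n T' hT'
  have key : ∀ (hn : 1 ≤ n),
      2 * (∑ ρ ∈ zerosBetween (Real.sqrt n) T', (riemannZetaZeroOrder ρ : ℝ) * liWindowWeight n ρ.im) -
        2 / Real.pi * (∫ t in Real.sqrt n..T', liWindowWeight n t * riemannSiegelThetaDeriv t) =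
      2 * (zetaArgS T' * liWindowWeight n T' - zetaArgS (Real.sqrt n) * liWindowWeight n (Real.sqrt n) -
        ∫ t in Real.sqrt n..T', zetaArgS t * liWindowWeightDeriv n t) := by
    intro hn
    have hn' : (1 : ℝ) ≤ n := by exact_mod_cast hn
    have ha : 0 < Real.sqrt n := Real.sqrt_pos.2 (by linarith)
    have hab : Real.sqrt n ≤ T' := by
      have h1 : Real.sqrt n ≤ n := by
        rw [Real.sqrt_le_left (by linarith)]
        nlinarith
      have h2 : (n : ℝ) ≤ (n : ℝ) ^ 2 := by nlinarith
      linarith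
    rw [Window.windowIdentity ha.le hab
      (fun t ht ↦ hasDerivAt_liWindowWeight n (by linarith [ht.1] : t ≠ 0))
      (continuousOn_liWindowWeightDeriv n ha)]
    ring
  constructor
  · intro hn
    rw [key (le_trans (by norm_num) hn)]
    exact liOscillatoryPlain_bound n T' hn hT'
  · intro hn
    rw [key (le_trans (by norm_num) hn)]
    exact liOscillatoryTuring_bound n T' hn hT'

/-- **Item `LiOscillatoryS` of route `LiAsymptotic`** (stmt-RiemannHypothesis-19164), closed BY NAME. -/
theorem liOscillatoryS_proof : Summit.RiemannHypothesis.RiemannHypothesis.Theses.LiAsymptotic.LiOscillatoryS :=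
  liOscillatoryS_bound

end Summit.RiemannHypothesis.RiemannHypothesis.Theorems.LiTheory

end
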